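import Mathlib
import HarnessLib
import Literature.Analysis.FluidPDE.SelfSimilar
import Literature.Analysis.FluidPDE.NSBoundedMildOseen
import Literature.Analysis.FluidPDE.VectorCalculus
import Literature.Analysis.FluidPDE.VorticityCalculus
import Literature.Topology.PlaneTopology.JordanCurve
import Literature.Topology.PlaneTopology.JordanCurveProofs

/-!
# Route `PoloidalWindowDoor`, crux `PoloidalWindowRigidity` (K2, stmt-NavierStokesRegularity-19708) — LINE 20 «hot_forest» (ns-idea-8 g10):
# F1a `NoHotCycle` — NO HOT CYCLE, VERBATIM (Cruxes-local `Pinned` / `Peakless` / `hotSet` delta-unfolded)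

Cell ns-regularity-ideate, seat ns-poloidal-K2-p2 g14 (K2 stub-worker hand; KEY-NS #198).  Statement = `NoHotCycle` of
`Cruxes/PoloidalWindowRigidity/Lines/hot_forest.lean` (v1.2, sha16 da0c3e1f437fc85c; l.343–349): a pinned, peakless profile whose hot set
`H = {y : y₂ = 0, v₂(−1,y) = N}` (`N = v₂(−1,0) ≠ 0`) has no planar interior point carries NO continuous `1`-periodic curve, injective on
`[0,1)`, running inside `H`.

PROOF (the line card's, with idea-crit-8's bracket instance).
* `no_level_cycle` (abstract, planar): for a continuous `g : ℝ³ → ℝ` with `g ≤ M` on the plane `P₀ = {y₂ = 0}`, whose top level set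
  `{y ∈ P₀ : g y = M}` has empty planar interior and which admits no VALLEY BRACKET on `P₀` (a compact non-empty `K ⊆ P₀` on which `g = m`,
  an open `O ⊇ K` on whose trace `g ≥ m` with equality only on `K`), no Jordan curve runs in the top level set.  Indeed the planar curve
  `θ ↦ ⟨c θ 0, c θ 1⟩ : ℂ` is continuous, `1`-periodic and injective on `[0,1)`, so the tree's JORDAN CURVE THEOREM
  (`Literature.Topology.PlaneTopology.JordanCurveTheorem_holds`, `JordanCurveTheorem.of_periodic`) gives a bounded complementary component
  `U` with `frontier U =` the curve; `F := g ∘ ι` (`ι : ℂ → P₀` the chart) attains its minimum `m` on the compact `closure U`, and `F = M`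
  on `frontier U`.  If `m = M` then `F ≡ M` on the open non-empty `U`, and the no-interior hypothesis at a point of `ι(U)` produces a
  nearby planar point with `g ≠ M` projecting into `U` — absurd.  If `m < M` the minimisers avoid the frontier, so
  `K := ι(argmin)` is a compact non-empty subset of the open cylinder `O := pr⁻¹(U)`, on whose planar trace `g ≥ m` with equality exactly
  on `K` — a valley bracket.
* `noHotCycle` (VERBATIM F1a): `g := σ·v₂(−1,·)`, `σ = sign N`, `M := |N|`; `g ≤ |N|` on `ℝ³` is the pinned global bound at `t = −1`,
  the top level set is the hot set, slice continuity comes from `Pinned`'s joint continuity, and a valley bracket `(m, K, O)` of `g` is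
  the island bracket `(s, z₀, σ', M') = (−1, 0, −σ, −m)` of `Peakless` — idea-crit-8's instance.

WHAT THIS IS NOT: not a claim about Navier–Stokes regularity — plane topology for ONE load-bearing support stub (F1a) of an ideator line of a
door route (bears_on LADDER-NS N0, rung N0-LocalTubeDoorPoloidal, W4 ⟨19708⟩); the research cells ESC-END / CONVERGENT-WEB, C2a′/C2b′, S0,
⟨27893⟩ stay OPEN; crux 19708 / item 20428 OPEN; NS regularity NOT proved.
-/

noncomputable section

-- the summit and its single sub-problem share the name (CONVENTIONS §1), as in every Theorems file
set_option linter.dupNamespace false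

namespace Summit.NavierStokesRegularity.NavierStokesRegularity.Theorems.PoloidalWindowDoorPoloidalWindowRigidityHotForestNoHotCycle

open Set Function Filter Topology Metric
open scoped InnerProductSpace RealInnerProductSpace Laplacian
open Literature.Topology.PlaneTopology

/-! ## The abstract planar lemma -/

/-- **No Jordan curve in a top level set with empty planar interior and no valley bracket.**  See the module docstring. [folklore] -/
theorem no_level_cycle {g : EuclideanSpace ℝ (Fin 3) → ℝ} (hg : Continuous g) {M : ℝ}
    (hle : ∀ y : EuclideanSpace ℝ (Fin 3), y 2 = 0 → g y ≤ M)
    (hni : ∀ y : EuclideanSpace ℝ (Fin 3), y 2 = 0 → g y = M → ∀ r : ℝ, 0 < r →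
      ∃ y' : EuclideanSpace ℝ (Fin 3), y' 2 = 0 ∧ dist y' y < r ∧ g y' ≠ M)
    (hpk : ∀ (m : ℝ) (K O : Set (EuclideanSpace ℝ (Fin 3))), IsCompact K → K.Nonempty → (∀ y ∈ K, y 2 = 0 ∧ g y = m) →
      IsOpen O → K ⊆ O → (∀ y ∈ O, y 2 = 0 → m ≤ g y) → (∀ y ∈ O, y 2 = 0 → g y = m → y ∈ K) → False)
    {c : ℝ → EuclideanSpace ℝ (Fin 3)} (hc : Continuous c) (hper : ∀ θ : ℝ, c (θ + 1) = c θ) (hinj : Set.InjOn c (Set.Ico 0 1))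
    (hcH : ∀ θ : ℝ, c θ 2 = 0 ∧ g (c θ) = M) : False := by
  -- the planar chart of `P₀`: `pr : ℝ³ → ℂ`, `ι : ℂ → P₀`
  set pr : EuclideanSpace ℝ (Fin 3) → ℂ := fun y => ⟨y 0, y 1⟩ with hpr
  set ι : ℂ → EuclideanSpace ℝ (Fin 3) := fun z =>
    z.re • EuclideanSpace.single (0 : Fin 3) (1 : ℝ) + z.im • EuclideanSpace.single (1 : Fin 3) (1 : ℝ) with hι
  have continuous_pr : Continuous pr := by
    have h0 : Continuous fun y : EuclideanSpace ℝ (Fin 3) => y 0 := (EuclideanSpace.proj (𝕜 := ℝ) (0 : Fin 3)).continuous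
    have h1 : Continuous fun y : EuclideanSpace ℝ (Fin 3) => y 1 := (EuclideanSpace.proj (𝕜 := ℝ) (1 : Fin 3)).continuous
    exact (Complex.equivRealProdCLM.symm.continuous.comp (h0.prodMk h1)).congr fun y => rfl
  have continuous_ι : Continuous ι :=
    (Complex.continuous_re.smul continuous_const).add (Complex.continuous_im.smul continuous_const)
  have ι_apply_two : ∀ z : ℂ, ι z 2 = 0 := fun z => by simp [hι]
  have pr_ι : ∀ z : ℂ, pr (ι z) = z := fun z => by apply Complex.ext <;> simp [hpr, hι]
  have ι_pr : ∀ {y : EuclideanSpace ℝ (Fin 3)}, y 2 = 0 → ι (pr y) = y := fun {y} hy => by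
    ext i
    fin_cases i <;> simp [hpr, hι, hy]
  -- the planar Jordan curve
  set c' : ℝ → ℂ := fun θ => pr (c θ) with hc'
  have hcc : Continuous c' := continuous_pr.comp hc
  have hcp : Function.Periodic c' 1 := fun θ => by simp only [hc', hper]
  have hcinj : Set.InjOn c' (Set.Ico 0 1) := by
    intro a ha b hb hab
    refine hinj ha hb ?_
    have h := congrArg ι hab
    simp only [hc'] at h
    rwa [ι_pr (hcH a).1, ι_pr (hcH b).1] at h
  obtain ⟨U, V, hUo, -, hUc, -, -, -, hfU, -, hUbdd, -⟩ :=
    JordanCurveTheorem.of_periodic JordanCurveTheorem_holds hcc hcp hcinj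
  have hUne : U.Nonempty := hUc.nonempty
  -- `F := g ∘ ι` attains its minimum on the compact `closure U`
  set F : ℂ → ℝ := fun z => g (ι z) with hF
  have hFc : Continuous F := hg.comp continuous_ι
  have hcl : IsCompact (closure U) := hUbdd.isCompact_closure
  obtain ⟨z₀, hz₀, hmin⟩ := hcl.exists_isMinOn (hUne.mono subset_closure) hFc.continuousOn
  rw [isMinOn_iff] at hmin
  -- `F = M` on the frontier, `F ≤ M` everywhere
  have hfr : ∀ z ∈ frontier U, F z = M := by
    intro z hz
    rw [hfU] at hz
    obtain ⟨θ, rfl⟩ := hz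
    show g (ι (pr (c θ))) = M
    rw [ι_pr (hcH θ).1]
    exact (hcH θ).2
  have hFle : ∀ z, F z ≤ M := fun z => hle _ (ι_apply_two z)
  have hO : IsOpen (pr ⁻¹' U) := hUo.preimage continuous_pr
  by_cases hM : F z₀ = M
  · -- an open planar disc would be in the top level set
    obtain ⟨u, hu⟩ := hUne
    have hFu : ∀ z ∈ U, F z = M := fun z hz => le_antisymm (hFle z) (hM ▸ hmin z (subset_closure hz))
    have hιu : ι u ∈ pr ⁻¹' U := by
      show pr (ι u) ∈ U
      rw [pr_ι]
      exact hu
    obtain ⟨r, hr, hball⟩ := Metric.isOpen_iff.1 hO (ι u) hιu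
    obtain ⟨y', hy'2, hy'd, hy'g⟩ := hni (ι u) (ι_apply_two u) (hFu u hu) r hr
    have hpy' : pr y' ∈ U := hball (mem_ball.2 hy'd)
    have h := hFu _ hpy'
    have e : F (pr y') = g y' := by
      show g (ι (pr y')) = g y'
      rw [ι_pr hy'2]
    exact hy'g (e ▸ h)
  · -- a valley inside `U`: a bracket
    have hlt : F z₀ < M := lt_of_le_of_ne (hFle z₀) hM
    have hinU : ∀ z ∈ closure U, F z = F z₀ → z ∈ U := by
      intro z hz hFz
      by_contra hzU
      have hzfr : z ∈ frontier U := by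
        rw [hUo.frontier_eq]
        exact ⟨hz, hzU⟩
      have := hfr z hzfr
      linarith
    set K : Set (EuclideanSpace ℝ (Fin 3)) := ι '' (closure U ∩ F ⁻¹' {F z₀}) with hK
    have hKc : IsCompact K := (hcl.inter_right (isClosed_singleton.preimage hFc)).image continuous_ι
    have hKne : K.Nonempty := ⟨ι z₀, mem_image_of_mem ι ⟨hz₀, rfl⟩⟩
    refine hpk (F z₀) K (pr ⁻¹' U) hKc hKne ?_ hO ?_ ?_ ?_
    · rintro _ ⟨z, ⟨-, hFz⟩, rfl⟩
      exact ⟨ι_apply_two z, hFz⟩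
    · rintro _ ⟨z, ⟨hz, hFz⟩, rfl⟩
      show pr (ι z) ∈ U
      rw [pr_ι]
      exact hinU z hz hFz
    · intro y hy hy2
      have h := hmin (pr y) (subset_closure hy)
      have e : F (pr y) = g y := by
        show g (ι (pr y)) = g y
        rw [ι_pr hy2]
      exact e ▸ h
    · intro y hy hy2 hgy
      refine ⟨pr y, ⟨subset_closure hy, ?_⟩, ι_pr hy2⟩
      show g (ι (pr y)) = F z₀
      rw [ι_pr hy2]
      exact hgy

/-! ## F1a, VERBATIM -/

/-- **F1a `NoHotCycle` of LINE 20 «hot_forest» (VERBATIM; `Pinned` / `Peakless` / `hotSet` unfolded).**  A pinned, peakless profile whose hot set has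
no planar interior point carries no hot cycle.  See the module docstring. -/
theorem noHotCycle :
    ∀ (C : ℝ) (v : ℝ → EuclideanSpace ℝ (Fin 3) → EuclideanSpace ℝ (Fin 3)),
      (Literature.Analysis.FluidPDE.HasTypeITimeDecay C v ∧
        ContinuousOn (Function.uncurry v) (Set.Iio (0 : ℝ) ×ˢ Set.univ) ∧
        (∀ s t : ℝ, s < t → t < 0 → ∀ x, v t x =
          Literature.Analysis.UnboundedOperators.heatExtension (v s) (t - s) x -
            Literature.Analysis.FluidPDE.oseenDuhamel 1 s v v t x) ∧
        (∀ t < 0, Literature.Analysis.FluidPDE.VectorCalculus.IsDivFree (v t)) ∧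
        (∀ s < 0, ∀ y, ⟪Literature.Analysis.FluidPDE.curl (v s) y, EuclideanSpace.single 2 1⟫_ℝ = 0) ∧
        v (-1) 0 2 ≠ 0 ∧ (∀ t < 0, ∀ x, Real.sqrt (-t) * |v t x 2| ≤ |v (-1) 0 2|) ∧
        (∀ h : EuclideanSpace ℝ (Fin 3), fderiv ℝ (v (-1)) 0 h 2 = 0) ∧
        (deriv (fun s => v s 0 2) (-1) = v (-1) 0 2 / 2 ∧ v (-1) 0 2 * (Δ (fun y => v (-1) y 2)) 0 ≤ 0)) →
      (∀ (s z₀ σ M : ℝ) (K O : Set (EuclideanSpace ℝ (Fin 3))), s < 0 →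
        ((σ = 1 ∨ σ = -1) ∧ IsCompact K ∧ K.Nonempty ∧ (∀ y ∈ K, y 2 = z₀ ∧ σ * v s y 2 = M) ∧
          IsOpen O ∧ K ⊆ O ∧ (∀ y ∈ O, y 2 = z₀ → σ * v s y 2 ≤ M) ∧
          (∀ y ∈ O, y 2 = z₀ → σ * v s y 2 = M → y ∈ K)) → False) →
      (∀ y ∈ {y : EuclideanSpace ℝ (Fin 3) | y 2 = 0 ∧ v (-1) y 2 = v (-1) 0 2}, ∀ r : ℝ, 0 < r →
        ∃ y' : EuclideanSpace ℝ (Fin 3), y' 2 = 0 ∧ dist y' y < r ∧ v (-1) y' 2 ≠ v (-1) 0 2) →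
      ∀ c : ℝ → EuclideanSpace ℝ (Fin 3), Continuous c → (∀ θ : ℝ, c (θ + 1) = c θ) → Set.InjOn c (Set.Ico 0 1) →
        (∀ θ : ℝ, c θ ∈ {y : EuclideanSpace ℝ (Fin 3) | y 2 = 0 ∧ v (-1) y 2 = v (-1) 0 2}) → False := by
  intro C v hP hpk hni c hc hper hinj hhot
  obtain ⟨-, hcont, -, -, -, hN, hbd, -, -⟩ := hP
  -- the sign of `N`
  set N : ℝ := v (-1) 0 2 with hNdef
  obtain ⟨σ, hσ, hσN⟩ : ∃ σ : ℝ, (σ = 1 ∨ σ = -1) ∧ σ * N = |N| := by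
    rcases lt_or_gt_of_ne hN with h | h
    · exact ⟨-1, Or.inr rfl, by rw [abs_of_neg h]; ring⟩
    · exact ⟨1, Or.inl rfl, by rw [abs_of_pos h]; ring⟩
  have hσ0 : σ ≠ 0 := by rcases hσ with rfl | rfl <;> norm_num
  have hσabs : |σ| = 1 := by rcases hσ with rfl | rfl <;> norm_num
  -- slice continuity
  have hw : Continuous fun y : EuclideanSpace ℝ (Fin 3) => v (-1) y 2 := by
    have h1 : Continuous fun y : EuclideanSpace ℝ (Fin 3) => v (-1) y :=
      hcont.comp_continuous (continuous_const.prodMk continuous_id) fun y => ⟨by norm_num, Set.mem_univ _⟩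
    exact (EuclideanSpace.proj (𝕜 := ℝ) (2 : Fin 3)).continuous.comp h1
  have hg : Continuous fun y : EuclideanSpace ℝ (Fin 3) => σ * v (-1) y 2 := continuous_const.mul hw
  -- level `M = |N|` ⇔ hot
  have hlev : ∀ y : EuclideanSpace ℝ (Fin 3), σ * v (-1) y 2 = |N| ↔ v (-1) y 2 = N := fun y => by
    rw [← hσN]
    exact ⟨fun h => mul_left_cancel₀ hσ0 h, fun h => by rw [h]⟩
  refine no_level_cycle hg (M := |N|) ?_ ?_ ?_ hc hper hinj fun θ => ⟨(hhot θ).1, (hlev _).2 (hhot θ).2⟩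
  · intro y _
    have h := hbd (-1) (by norm_num) y
    rw [neg_neg, Real.sqrt_one, one_mul] at h
    calc σ * v (-1) y 2 ≤ |σ * v (-1) y 2| := le_abs_self _
      _ = |v (-1) y 2| := by rw [abs_mul, hσabs, one_mul]
      _ ≤ |N| := h
  · intro y hy2 hyM r hr
    obtain ⟨y', hy'2, hy'd, hy'N⟩ := hni y ⟨hy2, (hlev y).1 hyM⟩ r hr
    exact ⟨y', hy'2, hy'd, fun h => hy'N ((hlev y').1 h)⟩
  · intro m K O hKc hKne hK hO hKO hOle hOeq
    refine hpk (-1) 0 (-σ) (-m) K O (by norm_num) ⟨?_, hKc, hKne, ?_, hO, hKO, ?_, ?_⟩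
    · rcases hσ with rfl | rfl
      · exact Or.inr rfl
      · exact Or.inl (by norm_num)
    · intro y hy
      exact ⟨(hK y hy).1, by rw [neg_mul, (hK y hy).2]⟩
    · intro y hy hy2
      rw [neg_mul]
      exact neg_le_neg (hOle y hy hy2)
    · intro y hy hy2 h
      rw [neg_mul, neg_inj] at h
      exact hOeq y hy hy2 h

end Summit.NavierStokesRegularity.NavierStokesRegularity.Theorems.PoloidalWindowDoorPoloidalWindowRigidityHotForestNoHotCycle

end
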